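import Mathlib
import Literature.NumberTheory.Transcendental.LinEDS
import Literature.NumberTheory.Transcendental.LinEDSCode
import Literature.NumberTheory.Transcendental.MZVShuffleRegularisation
import Summits.KontsevichZagierPeriods.KontsevichZagierPeriods.Theorems.FurushoPentagonKernelModuloPeriodConjectureRowBitsParity
import Summits.KontsevichZagierPeriods.KontsevichZagierPeriods.Theorems.FurushoPentagonKernelModuloPeriodConjectureLeafOfCheck
import Summits.KontsevichZagierPeriods.KontsevichZagierPeriods.Theorems.FurushoPentagonKernelModuloPeriodConjectureLeafOfOddDet
import HarnessLib

/-!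
# `KernelModuloPeriodConjecture`, line `Sketch`: the leaf from an odd determinant, grouped rows

Crux `FurushoPentagon.KernelModuloPeriodConjecture` (stmt-KontsevichZagierPeriods-15058), line
`Sketch`, registered helper stub `stub_leaf_of_oddDetSum` (engine v2 soundness G2). The
generalisation of `stub_leaf_of_oddDet` (`…LeafOfOddDet.lean`, single row names) to GROUPED rows:
row `i` of the square integer relation matrix is the SUM of the integer EDS rows of a list `ν i`
of valid names, i.e. its entry at the column `col j` is `Σ_{μ ∈ ν i} entry k μ (col j)`. If the
columns `col j ∈ cols k` hit every column of the engine and this matrix has ODD determinant, then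
every admissible index of weight `k` has one Hoffman expansion valid at every group-like solution
of Drinfeld's pentagon over every (reduced) commutative `ℚ`-algebra. The proof is that of the
single-name case with the folded row of `i` replaced by the list sum
`Σ_{μ ∈ ν i} divFold (rowZ μ)`: it still vanishes at every pentagon solution (E5
`stub_eval_rowZ_divFold`, additivity of `evalZ`), is still supported on admissible words of
weight `k` (E9 `stub_rowBits_parity`), and its value at a column word is the matrix entry.
Ingredients: E5, E8 `stub_cols_spec`, E9, `oddDetE11_solve` (odd determinant ⇒ every standard
row vector is a rational combination of the rows).

References: K. Ihara, M. Kaneko, D. Zagier, Compos. Math. 142 (2006) §2 [IharaKanekoZagier2006].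
-/

namespace Summit.KontsevichZagierPeriods.FurushoPentagon.KernelModuloPeriodConjecture

open Literature.NumberTheory.Transcendental
open Literature.NumberTheory.Transcendental.LinEDS

/-- Odd determinant of a matrix whose columns are read off column labels ⇒ the labels are
distinct. [folklore] -/
theorem oddDetSumG_col_injective {ι : Type} [Fintype ι] [DecidableEq ι] (f : ι → ℕ → ℤ)
    (col : ι → ℕ) (hA : Odd (Matrix.of fun i j => f i (col j)).det) : Function.Injective col := by
  intro j j' h
  by_contra hne
  have h0 : (Matrix.of fun i j => f i (col j)).det = 0 :=
    Matrix.det_zero_of_column_eq hne (fun i => by rw [Matrix.of_apply, Matrix.of_apply, h])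
  rw [h0] at hA
  exact absurd (Int.odd_iff.1 hA) (by decide)

/-- A list sum of finitely supported functions, evaluated: the list sum of the values.
[folklore] -/
theorem oddDetSumG_list_sum_apply {α M : Type*} [AddCommMonoid M] :
    ∀ (l : List (α →₀ M)) (a : α), l.sum a = (l.map fun f => f a).sum
  | [], a => by simp
  | f :: l, a => by
    rw [List.sum_cons, List.map_cons, List.sum_cons, Finsupp.add_apply, oddDetSumG_list_sum_apply l a]

/-- The support of a list sum of finitely supported functions lies in any finset containing the
supports of the summands. [folklore] -/
theorem oddDetSumG_support_list_sum_subset {α M : Type*} [DecidableEq α] [AddCommMonoid M]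
    {s : Finset α} : ∀ l : List (α →₀ M), (∀ f ∈ l, f.support ⊆ s) → l.sum.support ⊆ s
  | [], _ => by simp
  | f :: l, h => by
    rw [List.sum_cons]
    exact Finsupp.support_add.trans (Finset.union_subset (h f (by simp))
      (oddDetSumG_support_list_sum_subset l fun f' hf' => h f' (by simp [hf'])))

/-- **The leaf from an odd determinant, grouped rows** (registered helper stub
`stub_leaf_of_oddDetSum`, lead c6, engine v2 soundness G2; crux stmt-KontsevichZagierPeriods-15058,
line `Sketch`): lists of valid row names and columns of weight `k` indexed by any finite type,
columns hitting every column of the engine, odd determinant of the integer matrix whose row `i` is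
the sum of the EDS rows named in `ν i` ⇒ the weight-`k` slice of the algebraic leaf.
[cite: IharaKanekoZagier2006, Conjecture 1] -/
theorem stub_leaf_of_oddDetSum :
    ∀ (k : ℕ) (ι : Type) [Fintype ι] [DecidableEq ι] (ν : ι → List (List ℕ × List ℕ))
      (col : ι → ℕ), 2 ≤ k → (∀ i, ∀ μ ∈ ν i, LinEDS.validName k μ = true) →
      (∀ j, col j ∈ LinEDS.cols k) → (∀ c ∈ LinEDS.cols k, ∃ j, col j = c) →
      Odd (Matrix.of fun i j => ((ν i).map fun μ => LinEDS.entry k μ (col j)).sum).det →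
      ∀ s : List ℕ, MZV.IsAdmissible s → MZV.weight s = k →
        ∃ b : List ℕ →₀ ℚ, (∀ t ∈ b.support, MZV.IsHoffman t ∧ MZV.weight t = MZV.weight s) ∧ ∀ (R : Type) [CommRing R] [Algebra ℚ R] [IsReduced R] (φ : NCSeries Bool R), NCSeries.IsGroupLike φ → NCSeries.DrinfeldPentagon φ → φ (MZV.binaryWord s) = b.sum (fun t q => q • φ (MZV.binaryWord t)) := by
  classical
  intro k ι _ _ ν col hk2 hvalid hcolmem hcolsurj hdet s hs hw
  by_cases hH : MZV.IsHoffman s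
  · exact leafLowWeight_of_isHoffman hH
  have hs0 : s ≠ [] := by rintro rfl; exact hH fun i hi => by simp at hi
  obtain ⟨a, s', rfl⟩ := List.exists_cons_of_ne_nil hs0
  obtain ⟨hpw, hcols, hhof, -⟩ := stub_cols_spec k hk2
  -- the column of `s`
  set c₀ := LinEDS.code (MZV.binaryWord (a :: s')) with hc₀
  have hwlen : (MZV.binaryWord (a :: s')).length = k := by rw [MZV.length_binaryWord hs.1, hw]
  obtain ⟨hc₀lt, hc₀odd⟩ := masterE10_code_binaryWord hs hs0
  rw [hw] at hc₀lt
  have hwc₀ : LinEDS.wordOfCode k c₀ = MZV.binaryWord (a :: s') := by rw [hc₀, ← hwlen, wordOfCode_code]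
  have hc₀col : c₀ ∈ LinEDS.cols k := by
    refine (hcols c₀).mpr ⟨hc₀lt, hc₀odd, ?_⟩
    rintro ⟨t, ht, htw⟩
    rw [hwc₀] at htw
    have hpos : ∀ i ∈ t, 1 ≤ i := fun i hi => by rcases ht i hi with rfl | rfl <;> omega
    have := congrArg MZV.ofBinaryWord htw
    rw [MZV.ofBinaryWord_binaryWord hpos, MZV.ofBinaryWord_binaryWord hs.1] at this
    subst this
    exact hH ht
  have hinj : Function.Injective col :=
    oddDetSumG_col_injective (fun i c => ((ν i).map fun μ => LinEDS.entry k μ c).sum) col hdet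
  obtain ⟨j₀, hcolj₀⟩ := hcolsurj c₀ hc₀col
  obtain ⟨l, hl⟩ := oddDetE11_solve _ hdet j₀
  -- the folded (grouped) integer rows and their coefficients
  let g : ι → (List Bool →₀ ℤ) := fun i => ((ν i).map fun μ => LinEDS.divFold (LinEDS.rowZ μ)).sum
  have hentry : ∀ i c, g i (LinEDS.wordOfCode k c) = ((ν i).map fun μ => LinEDS.entry k μ c).sum := by
    intro i c
    show ((ν i).map fun μ => LinEDS.divFold (LinEDS.rowZ μ)).sum (LinEDS.wordOfCode k c) = _
    rw [oddDetSumG_list_sum_apply, List.map_map]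
    rfl
  let coef : List Bool → ℚ := fun w => ∑ i, l i * (g i w : ℚ)
  have hcoef_col : ∀ j, coef (LinEDS.wordOfCode k (col j)) = if j = j₀ then 1 else 0 := fun j => by
    rw [← hl j]
    refine Finset.sum_congr rfl fun i _ => ?_
    rw [hentry, Matrix.of_apply]
  have hcoef_cols : ∀ c ∈ LinEDS.cols k, coef (LinEDS.wordOfCode k c) = if c = c₀ then 1 else 0 := by
    intro c hc
    obtain ⟨j, rfl⟩ := hcolsurj c hc
    rw [hcoef_col]
    by_cases hj : j = j₀
    · subst hj; simp [hcolj₀]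
    · rw [if_neg hj, if_neg]
      intro h; exact hj (hinj (h.trans hcolj₀.symm))
  -- the answer
  let T : Finset (List ℕ) := (LinEDS.hofLists k).toFinset
  refine ⟨∑ t ∈ T, Finsupp.single t (-coef (MZV.binaryWord t)), fun t ht => ?_,
    fun R _ _ _ φ hg h5 => ?_⟩
  · -- support
    have ht' : t ∈ T := by
      by_contra hnot
      rw [Finsupp.mem_support_iff, Finsupp.finsetSum_apply] at ht
      exact ht (Finset.sum_eq_zero fun t' ht'' => Finsupp.single_eq_of_ne fun h => hnot (h ▸ ht''))
    obtain ⟨hH', hwt⟩ := (hhof t).mp (List.mem_toFinset.mp ht')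
    exact ⟨hH', by rw [hwt, hw]⟩
  · -- the identity at a pentagon solution
    have h1 : φ [true] = 0 := h5.apply_letter_eq_zero_of_isGroupLike hg true
    -- every folded row of a valid name evaluates to zero, hence so does every grouped row
    have hev1 : ∀ μ, LinEDS.validName k μ = true →
        LinEDS.evalZ φ (LinEDS.divFold (LinEDS.rowZ μ)) = 0 := fun μ hμ => by
      rw [stub_eval_rowZ_divFold.2 R φ hg h1 _ (fun w hw =>
        (stub_rowZ_support_shape k _ hμ w hw).2.1)]
      exact stub_eval_rowZ_divFold.1 R φ hg h5 k _ hμ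
    have hev : ∀ i, LinEDS.evalZ φ (g i) = 0 := fun i => by
      show LinEDS.evalZ φ ((ν i).map fun μ => LinEDS.divFold (LinEDS.rowZ μ)).sum = 0
      rw [evalE5_evalZ_list_sum]
      refine List.sum_eq_zero fun x hx => ?_
      obtain ⟨μ, hμ, rfl⟩ := List.mem_map.mp hx
      exact hev1 μ (hvalid i μ hμ)
    -- the common finite set of words: column words and Hoffman words
    let Wc : Finset (List Bool) := ((LinEDS.cols k).map (LinEDS.wordOfCode k)).toFinset
    let Wh : Finset (List Bool) := T.image MZV.binaryWord
    have hsupp1 : ∀ μ, LinEDS.validName k μ = true →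
        (LinEDS.divFold (LinEDS.rowZ μ)).support ⊆ Wc ∪ Wh := by
      intro μ hμ w hw
      obtain ⟨hwl, hwh, hwlast⟩ := (stub_rowBits_parity k _ hμ).2.2 w hw
      have hne : w ≠ [] := by rintro rfl; simp at hwh
      -- admissible code
      have hcodelt : LinEDS.code w < 2 ^ (k - 1) := by
        rw [List.eq_cons_of_mem_head? hwh, code_cons]
        simp only [Bool.toNat_false, zero_mul, zero_add]
        have := code_lt w.tail
        rwa [List.length_tail, hwl] at this
      have hcodeodd : LinEDS.code w % 2 = 1 := by
        have h0 : (LinEDS.code w).testBit 0 = true := by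
          rw [testBit_code]
          obtain ⟨w', hw'⟩ := List.getLast?_eq_some_iff.mp hwlast
          rw [hw']; simp
        simpa using h0
      have hww : LinEDS.wordOfCode k (LinEDS.code w) = w := by rw [← hwl, wordOfCode_code]
      by_cases hcw : LinEDS.code w ∈ LinEDS.cols k
      · exact Finset.mem_union_left _ (List.mem_toFinset.mpr
          (List.mem_map.mpr ⟨_, hcw, hww⟩))
      · have : ∃ t, MZV.IsHoffman t ∧ MZV.binaryWord t = LinEDS.wordOfCode k (LinEDS.code w) := by
          by_contra hno
          exact hcw ((hcols _).mpr ⟨hcodelt, hcodeodd, hno⟩)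
        obtain ⟨t, ht, htw⟩ := this
        rw [hww] at htw
        refine Finset.mem_union_right _ (Finset.mem_image.mpr ⟨t, List.mem_toFinset.mpr ?_, htw⟩)
        refine (hhof t).mpr ⟨ht, ?_⟩
        have hpos : ∀ i ∈ t, 1 ≤ i := fun i hi => by rcases ht i hi with rfl | rfl <;> omega
        rw [← MZV.length_binaryWord hpos, htw, hwl]
    have hsupp : ∀ i, (g i).support ⊆ Wc ∪ Wh := fun i =>
      oddDetSumG_support_list_sum_subset _ fun f hf => by
        obtain ⟨μ, hμ, rfl⟩ := List.mem_map.mp hf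
        exact hsupp1 μ (hvalid i μ hμ)
    have hdisj : Disjoint Wc Wh := by
      rw [Finset.disjoint_left]
      intro w hwc hwh
      obtain ⟨c, hc, rfl⟩ := List.mem_map.mp (List.mem_toFinset.mp hwc)
      obtain ⟨t, ht, htw⟩ := Finset.mem_image.mp hwh
      exact ((hcols c).mp hc).2.2 ⟨t, ((hhof t).mp (List.mem_toFinset.mp ht)).1, htw⟩
    -- evaluation of each grouped row as a sum over the common set, with rational scalars
    have hevsum : ∀ i, LinEDS.evalZ φ (g i) = ∑ w ∈ Wc ∪ Wh, ((g i w : ℤ) : ℚ) • φ w := by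
      intro i
      unfold LinEDS.evalZ
      refine (Finsupp.sum_of_support_subset (g i) (hsupp i) (fun w n => n • φ w)
        (fun w _ => zero_smul ℤ (φ w))).trans ?_
      exact Finset.sum_congr rfl fun w _ => (Int.cast_smul_eq_zsmul ℚ _ _).symm
    -- combine with the rational coefficients `l`
    have hzero : ∑ w ∈ Wc ∪ Wh, coef w • φ w = 0 := by
      have : ∑ i, l i • LinEDS.evalZ φ (g i) = 0 := Finset.sum_eq_zero fun i _ => by
        rw [hev i, smul_zero]
      rw [← this]
      simp_rw [hevsum, Finset.smul_sum, smul_smul]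
      rw [Finset.sum_comm]
      exact Finset.sum_congr rfl fun w _ => by rw [← Finset.sum_smul]
    rw [Finset.sum_union hdisj] at hzero
    -- the column part is `φ (bw s)`
    have hcolpart : ∑ w ∈ Wc, coef w • φ w = φ (MZV.binaryWord (a :: s')) := by
      have hcodeinj : ∀ x ∈ LinEDS.cols k, ∀ y ∈ LinEDS.cols k,
          LinEDS.wordOfCode k x = LinEDS.wordOfCode k y → x = y := by
        intro x hx y hy hxy
        have hx' := ((hcols x).mp hx).1
        have hy' := ((hcols y).mp hy).1
        have := congrArg LinEDS.code hxy
        rwa [code_wordOfCode (lt_of_lt_of_le hx' (Nat.pow_le_pow_right (by norm_num) (by omega))),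
          code_wordOfCode (lt_of_lt_of_le hy' (Nat.pow_le_pow_right (by norm_num) (by omega)))] at this
      have hWc : Wc = (LinEDS.cols k).toFinset.image (LinEDS.wordOfCode k) := by
        ext w; simp [Wc, List.mem_toFinset]
      rw [hWc, Finset.sum_image (fun x hx y hy h => hcodeinj x (List.mem_toFinset.mp hx) y
        (List.mem_toFinset.mp hy) h)]
      rw [Finset.sum_congr rfl (g := fun c => if c = c₀ then φ (LinEDS.wordOfCode k c₀) else 0)
        (fun c hc => by
          rw [hcoef_cols c (List.mem_toFinset.mp hc)]
          by_cases h : c = c₀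
          · subst h; simp
          · simp [h]),
        Finset.sum_ite_eq', if_pos (List.mem_toFinset.mpr hc₀col), hwc₀]
    -- the Hoffman part is the `b`-sum
    have hhofpart : ∑ w ∈ Wh, coef w • φ w = ∑ t ∈ T, coef (MZV.binaryWord t) • φ (MZV.binaryWord t) := by
      refine Finset.sum_image fun t ht t' ht' h => ?_
      have hpos : ∀ i ∈ t, 1 ≤ i := fun i hi => by
        rcases ((hhof t).mp (List.mem_toFinset.mp ht)).1 i hi with rfl | rfl <;> omega
      have hpos' : ∀ i ∈ t', 1 ≤ i := fun i hi => by
        rcases ((hhof t').mp (List.mem_toFinset.mp ht')).1 i hi with rfl | rfl <;> omega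
      have := congrArg MZV.ofBinaryWord h
      rwa [MZV.ofBinaryWord_binaryWord hpos, MZV.ofBinaryWord_binaryWord hpos'] at this
    rw [hcolpart, hhofpart] at hzero
    rw [masterE10_sum_finset_single T _ (fun t q => q • φ (MZV.binaryWord t)) (fun t => zero_smul ℚ _)
      (fun t a b => add_smul a b _)]
    simp_rw [neg_smul, Finset.sum_neg_distrib]
    rw [eq_neg_iff_add_eq_zero, hzero]

end Summit.KontsevichZagierPeriods.FurushoPentagon.KernelModuloPeriodConjecture
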